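import Mathlib.Algebra.BigOperators.Fin
import Mathlib.Algebra.Order.BigOperators.Group.Finset
import Mathlib.Data.Fin.Tuple.Basic
import Mathlib.Data.Fintype.BigOperators
import Mathlib.Data.Real.Basic
import Mathlib.Algebra.Group.Pi.Lemmas
import Mathlib.Tactic.Ring
import Mathlib.Tactic.FieldSimp
import Mathlib.Tactic.Linarith
import Mathlib.Tactic.Positivity
import HarnessLib

/-!
# Box sums on `ℤ^d` are almost translation invariant (the Følner property of boxes) (gauge-boot, L1/L4 supplement)

HONEST FRAMING (cell `pub-gaugeboot`, page 1 of every file): the venture produces certified bounds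
on lattice expectations at stated coupling, gauge group, dimension and torus size; NOT a mass gap,
NOT a continuum limit, NOT a string tension; NOT Yang–Mills-summit-bearing (barriers
`FixedCouplingUltralocality`, `PerturbativeInvisibility`). Elementary combinatorics; it certifies no number.

## Content

For a bounded function `g : ℤ^d → ℝ`, `|g| ≤ M`, and the box `[0, k)^d` (parametrised by
`Fin d → Fin k`, `boxPt`):

* `boxSum k g = Σ_{b ∈ [0,k)^d} g b`; `abs_boxSum_le` (`≤ M k^d`);
* ★ `abs_boxSum_shift_single_sub_le` — shifting by a unit vector `e_j` changes the box sum by at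
  most `2 M k^{d-1}` (telescoping along the `j`-th coordinate: only the two faces survive);
* hence the normalised box averages are asymptotically invariant, `|avg (g (· + e_j)) - avg g| ≤ 2M/k`
  (`abs_boxAvg_shift_single_sub_le`).

Used by `BootstrapTranslationReductionBoxes.lean` (the reduced SDP bound of a Wilson loop on `ℤ^d`
is the infimum over boxes of the plain bound on its box average). Folklore (Følner 1955).
-/

noncomputable section

open Finset

namespace Summit.QuantumFields.GaugeBoot

namespace LatticeBox

variable {d : ℕ}

/-- **A point of the box `[0, k)^d`** as a point of `ℤ^d`. -/
def boxPt (k : ℕ) (b : Fin d → Fin k) : Fin d → ℤ := fun i => ((b i : ℕ) : ℤ)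

/-- **The box sum** `Σ_{b ∈ [0,k)^d} g b`. -/
def boxSum (k : ℕ) (g : (Fin d → ℤ) → ℝ) : ℝ := ∑ b : Fin d → Fin k, g (boxPt k b)

/-- The box sum is additive. -/
theorem boxSum_add (k : ℕ) (g h : (Fin d → ℤ) → ℝ) : boxSum k (g + h) = boxSum k g + boxSum k h := by
  simp only [boxSum, Pi.add_apply, sum_add_distrib]

/-- The box sum is homogeneous. -/
theorem boxSum_smul (k : ℕ) (c : ℝ) (g : (Fin d → ℤ) → ℝ) : boxSum k (c • g) = c * boxSum k g := by
  simp only [boxSum, Pi.smul_apply, smul_eq_mul, mul_sum]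

/-- The box sum of a difference. -/
theorem boxSum_sub (k : ℕ) (g h : (Fin d → ℤ) → ℝ) : boxSum k (g - h) = boxSum k g - boxSum k h := by
  simp only [boxSum, Pi.sub_apply, sum_sub_distrib]

/-- **Bound**: `|boxSum k g| ≤ M k^d`. -/
theorem abs_boxSum_le (k : ℕ) {g : (Fin d → ℤ) → ℝ} {M : ℝ} (hg : ∀ x, |g x| ≤ M) :
    |boxSum k g| ≤ M * (k : ℝ) ^ d := by
  unfold boxSum
  refine (abs_sum_le_sum_abs _ _).trans ?_
  calc ∑ b : Fin d → Fin k, |g (boxPt k b)| ≤ ∑ _b : Fin d → Fin k, M := sum_le_sum fun b _ => hg _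
    _ = M * (k : ℝ) ^ d := by
      rw [sum_const, card_univ, nsmul_eq_mul, Fintype.card_fun, Fintype.card_fin, Fintype.card_fin,
        mul_comm]
      push_cast
      ring

/-! ## The telescoping estimate -/

/-- Inserting a coordinate commutes with the embedding of the box. -/
theorem boxPt_insertNth {d : ℕ} (k : ℕ) (j : Fin (d + 1)) (t : Fin k) (b : Fin d → Fin k) :
    boxPt k (Fin.insertNth j t b) = Fin.insertNth (α := fun _ => ℤ) j ((t : ℕ) : ℤ) (boxPt k b) := by
  funext i
  rcases Fin.eq_self_or_eq_succAbove j i with rfl | ⟨i', rfl⟩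
  · simp only [boxPt, Fin.insertNth_apply_same]
  · simp only [boxPt, Fin.insertNth_apply_succAbove]

/-- Adding the unit vector `e_j` raises the inserted `j`-th coordinate by one. -/
theorem insertNth_add_single {d : ℕ} (j : Fin (d + 1)) (z : ℤ) (c : Fin d → ℤ) :
    Fin.insertNth (α := fun _ => ℤ) j z c + Pi.single j (1 : ℤ) = Fin.insertNth (α := fun _ => ℤ) j (z + 1) c := by
  funext i
  rcases Fin.eq_self_or_eq_succAbove j i with rfl | ⟨i', rfl⟩
  · simp only [Pi.add_apply, Fin.insertNth_apply_same, Pi.single_eq_same]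
  · simp only [Pi.add_apply, Fin.insertNth_apply_succAbove, Pi.single_apply,
      Fin.succAbove_ne, if_false, add_zero]

/-- ★ **Følner estimate for boxes**: shifting a bounded function by a unit vector changes its box
sum by at most two faces, `|Σ_{b} g (b + e_j) - Σ_{b} g b| ≤ 2 M k^{d}` on `[0,k)^{d+1}`. [folklore] -/
theorem abs_boxSum_shift_single_sub_le {d : ℕ} (k : ℕ) {g : (Fin (d + 1) → ℤ) → ℝ} {M : ℝ}
    (hg : ∀ x, |g x| ≤ M) (j : Fin (d + 1)) :
    |boxSum k (fun x => g (x + Pi.single j 1)) - boxSum k g| ≤ 2 * M * (k : ℝ) ^ d := by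
  -- reindex both sums through `(t, b') ↦ insertNth j t b'`
  have hre : ∀ h : (Fin (d + 1) → ℤ) → ℝ, boxSum k h =
      ∑ b' : Fin d → Fin k, ∑ t : Fin k, h (Fin.insertNth (α := fun _ => ℤ) j ((t : ℕ) : ℤ) (boxPt k b')) := fun h => by
    unfold boxSum
    rw [← Fintype.sum_equiv (Fin.insertNthEquiv (fun _ => Fin k) j) (fun p => h (boxPt k (Fin.insertNth j p.1 p.2)))
      (fun b => h (boxPt k b)) (fun p => rfl), Fintype.sum_prod_type, sum_comm]
    simp only [boxPt_insertNth]
  rw [hre, hre, ← sum_sub_distrib]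
  -- each fibre telescopes
  have hfib : ∀ b' : Fin d → Fin k,
      |∑ t : Fin k, g (Fin.insertNth (α := fun _ => ℤ) j ((t : ℕ) : ℤ) (boxPt k b') + Pi.single j 1) -
        ∑ t : Fin k, g (Fin.insertNth (α := fun _ => ℤ) j ((t : ℕ) : ℤ) (boxPt k b'))| ≤ 2 * M := fun b' => by
    set G : ℕ → ℝ := fun t => g (Fin.insertNth (α := fun _ => ℤ) j (t : ℤ) (boxPt k b')) with hG
    have h1 : ∑ t : Fin k, g (Fin.insertNth (α := fun _ => ℤ) j ((t : ℕ) : ℤ) (boxPt k b') + Pi.single j 1) =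
        ∑ t ∈ range k, G (t + 1) := by
      rw [← Fin.sum_univ_eq_sum_range (fun t => G (t + 1)) k]
      refine sum_congr rfl fun t _ => ?_
      simp only [hG, insertNth_add_single, Nat.cast_add, Nat.cast_one]
    have h2 : ∑ t : Fin k, g (Fin.insertNth (α := fun _ => ℤ) j ((t : ℕ) : ℤ) (boxPt k b')) = ∑ t ∈ range k, G t :=
      (Fin.sum_univ_eq_sum_range G k)
    rw [h1, h2, ← sum_sub_distrib, sum_range_sub]
    calc |G k - G 0| ≤ |G k| + |G 0| := abs_sub _ _
      _ ≤ M + M := add_le_add (hg _) (hg _)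
      _ = 2 * M := by ring
  refine (abs_sum_le_sum_abs _ _).trans ?_
  calc ∑ b' : Fin d → Fin k, |∑ t : Fin k, g (Fin.insertNth (α := fun _ => ℤ) j ((t : ℕ) : ℤ) (boxPt k b') + Pi.single j 1) -
          ∑ t : Fin k, g (Fin.insertNth (α := fun _ => ℤ) j ((t : ℕ) : ℤ) (boxPt k b'))|
        ≤ ∑ _b' : Fin d → Fin k, 2 * M := sum_le_sum fun b' _ => hfib b'
    _ = 2 * M * (k : ℝ) ^ d := by
      rw [sum_const, card_univ, nsmul_eq_mul, Fintype.card_fun, Fintype.card_fin, Fintype.card_fin,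
        mul_comm]
      push_cast
      ring

/-- ★ **Box averages are asymptotically invariant**: `|avg_k (g (· + e_j)) - avg_k g| ≤ 2M / k` for
the normalised averages over `[0,k)^{d+1}`, `k ≥ 1`. [folklore] -/
theorem abs_boxAvg_shift_single_sub_le {d : ℕ} {k : ℕ} (hk : 0 < k) {g : (Fin (d + 1) → ℤ) → ℝ} {M : ℝ}
    (hg : ∀ x, |g x| ≤ M) (j : Fin (d + 1)) :
    |((k : ℝ) ^ (d + 1))⁻¹ * boxSum k (fun x => g (x + Pi.single j 1)) - ((k : ℝ) ^ (d + 1))⁻¹ * boxSum k g|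
      ≤ 2 * M / k := by
  have hkpos : (0 : ℝ) < (k : ℝ) := Nat.cast_pos.2 hk
  have hkd : (0 : ℝ) < (k : ℝ) ^ (d + 1) := pow_pos hkpos _
  rw [← mul_sub, abs_mul, abs_of_pos (inv_pos.2 hkd)]
  calc ((k : ℝ) ^ (d + 1))⁻¹ * |boxSum k (fun x => g (x + Pi.single j 1)) - boxSum k g|
      ≤ ((k : ℝ) ^ (d + 1))⁻¹ * (2 * M * (k : ℝ) ^ d) :=
        mul_le_mul_of_nonneg_left (abs_boxSum_shift_single_sub_le k hg j) (inv_pos.2 hkd).le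
    _ = 2 * M / k := by
      field_simp
      ring

end LatticeBox

end Summit.QuantumFields.GaugeBoot

end
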